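import Summits.PneNP.PneNP.Theses.KrwChromaticSteering

/-!
# Birth skeleton (BC3) — crux `StandardFromStrong` of route `KrwChromaticSteering` (item stmt-PneNP-18539)

The crux (Meir's FIRST OBSTACLE, hardest-inner-function form, card item C2 of the route):

  `∃ c, ∀ m n ≥ 1, ∀ f` non-constant, `∃ g₀, ∀ g, ∀ P` solving `KW_{f ⋄ g₀}`,
  `∃ P'` solving the strong game `KW_f ⊛ KW_g` with `depth P' ≤ depth P + c·(⌊log₂(mn)⌋+1)`,

i.e. `max_g C(KW_f ⊛ KW_g) ≤ max_g C(KW_f ⋄ KW_g) + O(log(mn))`: a protocol that finds SOME differing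
entry of the composed matrices (for the ⋄-hardest inner function) can be forced, at logarithmic cost,
to find one in a row whose labels differ.

## The line: interpolate through the ROW-CERTIFIED composition game

Meir (2023, §1.1) splits the intuition behind the first obstacle into two sentences: (a) "the players
have to look for a solution in a row `i` where `a_i ≠ b_i` … finding such a row is solving `KW_f` on
`a, b`"; (b) "given such a row `i`, finding a solution `(i, j)` is solving `KW_g` on `X_i, Y_i`". We type
the game sitting exactly between standard and strong composition:

* `SolvesRC R f g` — the **row-certified composition game** `RC_{f,g}`: on `X ∈ (f⋄g)⁻¹(1)`,
  `Y ∈ (f⋄g)⁻¹(0)` output an ENTRY `(i, j)` with `X_{ij} ≠ Y_{ij}` (anywhere) AND a ROW `i'` with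
  `a_{i'} ≠ b_{i'}` (the certificate; `i'` need not be `i`). Trees are `KWTree ((Fin m × Fin n) × Fin m)`
  run on the matrices pulled back along the first projection (`pullback`), so leaves name (entry, row)
  pairs and node functions are arbitrary functions of the matrix.

  Every strong-game tree is an RC tree of the same depth (certify the output row: `certifyOwnRow`) and
  every RC tree is a standard-composition tree of the same depth (forget the certificate: `forgetRow`):
  `C(KW_f ⋄ KW_g) ≤ C(RC_{f,g}) ≤ C(KW_f ⊛ KW_g)`.

and split the crux's `O(log)` gap `strong − standard` (at the hardest inner functions) into the two gaps:

* `stub_rowCertification` (load-bearing, the first obstacle PROPER — sentence (a)):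
  `max_g C(RC_{f,g}) ≤ max_g C(KW_f ⋄ KW_g) + O(log(mn))` in the crux's `∃ g₀ ∀ g` protocol form: the
  ⋄-hardest standard composition already forces the players to KNOW a label-differing row at the end.
* `stub_entrySteering` (sentence (b) at the max level):
  `max_g C(KW_f ⊛ KW_g) ≤ max_g C(RC_{f,g}) + O(log(mn))`: once a good row is certified, the differing
  entry can be steered into a good row at logarithmic cost (for the RC-hardest inner function `g₁`).
  Two attacks: direct protocol surgery on RC trees; or an RC-version of the route's other crux
  (`StrongComposition` for `RC` with `γ = 1`: `max_g C(RC_{f,g}) ≥ C(KW_f) + n − O(log)`) followed by the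
  obvious protocol `solvesStrong_compose` (in the tree) — note that RC lower bound would subsume C1.

`body_of_sigs` proves (no sorry) that the two stub STATEMENTS imply the crux body (constant `c₁ + c₂`,
`g₀` of the first stub, chained through the `g₁` of the second); `StandardFromStrong_of` concludes the
crux BY NAME from the two stubs by name (A12 registrar shape); `sorry` occurs only inside `stub_*`.
The split is LOSSLESS: `rowCertification_of_crux` / `entrySteering_of_crux` (no sorry) derive each stub
statement back from the crux, so `crux ↔ stub₁ ∧ stub₂` and neither stub is known to give the crux alone.

## Why not the multiplexor detour (route header's foreseen split)
`HardwireStrong → MuxFromStandard (Meir 2023, Lemma 6) → MuxConversion`: in any faithful typing of the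
partially-half-duplex multiplexor compositions `KW_f ⊛ MUX_n`, `KW_f ⋄ MUX_n` (Meir 2023, Def. 18–19) one
has `Cp(KW_f ∘ MUX_n) = max_g C(KW_f ∘ KW_g)` up to `+ log(mn) + 3` for both `∘ ∈ {⋄, ⊛}` (hard-wiring
`g_A = g_B = g` one way; merging the family of optimal per-`g` protocols into one pair of strategy trees
the other way — Lemma 6 / Remark 7; in the promise version the equality is exact). Hence `MuxConversion`
`Cp(KW_f ⊛ MUX_n) ≤ Cp(KW_f ⋄ MUX_n) + O(log)` is the crux itself in multiplexor notation and the other two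
stubs are bookkeeping: a costume core. The multiplexor LANGUAGE remains available to the prover of
`stub_rowCertification` (it is where Meir's live-transcript / characteristic-graph tools live), but it is
not a decomposition.

Sources: Meir2023 = arXiv:2306.00615 (§1.1 the two obstacles; Def. 1; Lemma 6, Remark 7; §7);
dRMNPR20 = arXiv:2007.02740 (p.5: strong = standard in the monotone world, equal-label rows "might
contain solutions as well"); KarchmerRazWigderson1995 (§1, §5).
-/

set_option linter.dupNamespace false

namespace Summit.PneNP.PneNP.Cruxes.StandardFromStrong.Birth

open Literature.Computability.Complexity
open Summit.PneNP.PneNP.Theses.KrwChromaticSteering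

/-! ### The row-certified composition game `RC_{f,g}` -/

/-- Leaves / coordinates of the row-certified game: an ENTRY of the `m × n` board together with a ROW. -/
abbrev RCIdx (m n : ℕ) : Type := (Fin m × Fin n) × Fin m

/-- A matrix seen as an `RCIdx`-indexed vector through the first projection (the row component is
ignored), so that a `KWTree (RCIdx m n)` is run on matrices and its node functions are arbitrary
functions of the matrix. -/
def pullback {m n : ℕ} (X : Fin m × Fin n → Bool) : RCIdx m n → Bool := fun p => X p.1

@[simp] theorem pullback_apply {m n : ℕ} (X : Fin m × Fin n → Bool) (p : RCIdx m n) :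
    pullback X p = X p.1 := rfl

/-- `SolvesRC R f g`: the tree `R` solves the **row-certified composition game** `RC_{f,g}` — on every
`X ∈ (f ⋄ g)⁻¹(1)`, `Y ∈ (f ⋄ g)⁻¹(0)` its output `((i, j), i')` has `X (i, j) ≠ Y (i, j)` (a differing
entry, anywhere) and `g(X_{i'}) ≠ g(Y_{i'})` (a certified label-differing row). Between `Solves
(blockComp f g)` (entry only) and `SolvesStrong f g` (entry inside a label-differing row). -/
def SolvesRC {m n : ℕ} (R : KWTree (RCIdx m n)) (f : (Fin m → Bool) → Bool)
    (g : (Fin n → Bool) → Bool) : Prop :=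
  ∀ X Y : Fin m × Fin n → Bool, blockComp f g X = true → blockComp f g Y = false →
    X (R.run (pullback X) (pullback Y)).1 ≠ Y (R.run (pullback X) (pullback Y)).1 ∧
      rowLabels g X (R.run (pullback X) (pullback Y)).2 ≠ rowLabels g Y (R.run (pullback X) (pullback Y)).2

/-! ### The two stubs -/

/-- STUB (load-bearing; Meir's first obstacle proper, "the players must find a label-differing row"):
ROW CERTIFICATION at the hardest inner function — there is `c` such that for all `m`, `n ≥ 1` and
non-constant `f` some `g₀` makes every tree for the standard composition `KW_{f ⋄ g₀}` convertible, for
EVERY inner `g`, into a tree for the row-certified game `RC_{f,g}` at cost `c·(⌊log₂(mn)⌋+1)`; i.e.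
`max_g C(RC_{f,g}) ≤ max_g C(KW_f ⋄ KW_g) + O(log(mn))`. Open (XL). Why it might fail: a Sipser
`⊕₃ ⋄ ⊕₃` / threshold-type saving that answers in equal-label rows without ever isolating a good row
could grow to `ω(log mn)` at the ⋄-hardest `g₀` (dRMNPR20 p.5). -/
theorem stub_rowCertification :
    ∃ c : ℕ, ∀ m n : ℕ, 1 ≤ n → ∀ f : (Fin m → Bool) → Bool, (∃ a b, f a ≠ f b) →
      ∃ g₀ : (Fin n → Bool) → Bool, ∀ g : (Fin n → Bool) → Bool,
        ∀ P : KWTree (Fin m × Fin n), P.Solves (blockComp f g₀) →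
          ∃ R : KWTree (RCIdx m n), SolvesRC R f g ∧
            R.depth ≤ P.depth + c * (Nat.log 2 (m * n) + 1) := by
  sorry

/-- STUB (hard; "given a good row, the differing entry can be steered into a good row"):
ENTRY STEERING at the hardest inner function — there is `c` such that for all `m`, `n ≥ 1` and
non-constant `f` some `g₁` makes every tree for the row-certified game `RC_{f,g₁}` convertible, for EVERY
inner `g`, into a tree for the strong game `KW_f ⊛ KW_g` at cost `c·(⌊log₂(mn)⌋+1)`; i.e.
`max_g C(KW_f ⊛ KW_g) ≤ max_g C(RC_{f,g}) + O(log(mn))`. Open (L/XL). Attack: either directly, or via an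
RC-version of strong composition with `γ = 1` (`max_g C(RC_{f,g}) ≥ C(KW_f) + n − O(log)`, Meir-type) and
the obvious protocol `solvesStrong_compose` / `depth_compose` (in the tree) with a depth-hard `g`. Why it
might fail: a certified row `i'` far from the found entry leaves a `KW_g`-instance on row `i'` worth up
to `n` bits; if RC-hard inner functions are strictly easier than strong-hard ones by `ω(log mn)` the
comparison is false as typed. -/
theorem stub_entrySteering :
    ∃ c : ℕ, ∀ m n : ℕ, 1 ≤ n → ∀ f : (Fin m → Bool) → Bool, (∃ a b, f a ≠ f b) →
      ∃ g₁ : (Fin n → Bool) → Bool, ∀ g : (Fin n → Bool) → Bool,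
        ∀ R : KWTree (RCIdx m n), SolvesRC R f g₁ →
          ∃ P' : KWTree (Fin m × Fin n), P'.SolvesStrong f g ∧
            P'.depth ≤ R.depth + c * (Nat.log 2 (m * n) + 1) := by
  sorry

/-! ### Composition (kernel-checked, no sorry) -/

/-- COMPOSITION, implication form (no sorry, no stub used): the two stub STATEMENTS imply the crux BODY
(written out; the by-name conclusion is `StandardFromStrong_of` below). Constant `c₁ + c₂`; the `g₀` of
row certification; a `KW_{f⋄g₀}` tree becomes an `RC_{f,g₁}` tree for the `g₁` of entry steering
(`+c₁·L`), which becomes a `KW_f ⊛ KW_g` tree (`+c₂·L`), `L = ⌊log₂(mn)⌋+1`. -/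
theorem body_of_sigs
    (h₁ : ∃ c : ℕ, ∀ m n : ℕ, 1 ≤ n → ∀ f : (Fin m → Bool) → Bool, (∃ a b, f a ≠ f b) →
      ∃ g₀ : (Fin n → Bool) → Bool, ∀ g : (Fin n → Bool) → Bool,
        ∀ P : KWTree (Fin m × Fin n), P.Solves (blockComp f g₀) →
          ∃ R : KWTree (RCIdx m n), SolvesRC R f g ∧
            R.depth ≤ P.depth + c * (Nat.log 2 (m * n) + 1))
    (h₂ : ∃ c : ℕ, ∀ m n : ℕ, 1 ≤ n → ∀ f : (Fin m → Bool) → Bool, (∃ a b, f a ≠ f b) →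
      ∃ g₁ : (Fin n → Bool) → Bool, ∀ g : (Fin n → Bool) → Bool,
        ∀ R : KWTree (RCIdx m n), SolvesRC R f g₁ →
          ∃ P' : KWTree (Fin m × Fin n), P'.SolvesStrong f g ∧
            P'.depth ≤ R.depth + c * (Nat.log 2 (m * n) + 1)) :
    ∃ c : ℕ, ∀ m n : ℕ, 1 ≤ n → ∀ f : (Fin m → Bool) → Bool, (∃ a b, f a ≠ f b) →
      ∃ g₀ : (Fin n → Bool) → Bool, ∀ g : (Fin n → Bool) → Bool,
        ∀ P : KWTree (Fin m × Fin n), P.Solves (blockComp f g₀) →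
          ∃ P' : KWTree (Fin m × Fin n), P'.SolvesStrong f g ∧
            P'.depth ≤ P.depth + c * (Nat.log 2 (m * n) + 1) := by
  obtain ⟨c₁, h₁⟩ := h₁
  obtain ⟨c₂, h₂⟩ := h₂
  refine ⟨c₁ + c₂, fun m n hn f hf => ?_⟩
  obtain ⟨g₀, hg₀⟩ := h₁ m n hn f hf
  obtain ⟨g₁, hg₁⟩ := h₂ m n hn f hf
  refine ⟨g₀, fun g P hP => ?_⟩
  obtain ⟨R, hR, hdR⟩ := hg₀ g₁ P hP
  obtain ⟨P', hP', hdP'⟩ := hg₁ g R hR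
  refine ⟨P', hP', ?_⟩
  have hsplit : (c₁ + c₂) * (Nat.log 2 (m * n) + 1)
      = c₁ * (Nat.log 2 (m * n) + 1) + c₂ * (Nat.log 2 (m * n) + 1) := by
    ring
  omega

/-- THE SKELETON THEOREM (A12 shape): concludes the crux BY NAME from the two declared stubs by name;
its only debt is the two `stub_*` sorries (no direct sorry here). -/
theorem StandardFromStrong_of :
    Summit.PneNP.PneNP.Theses.KrwChromaticSteering.StandardFromStrong :=
  body_of_sigs stub_rowCertification stub_entrySteering

/-! ### The split is lossless: each stub statement follows from the crux (no sorry)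

`C(KW_f ⋄ KW_g) ≤ C(RC_{f,g}) ≤ C(KW_f ⊛ KW_g)` by relabelling (`KWTree.comap`), whence
`crux → stub₁` (certify the output row of the strong tree the crux provides) and `crux → stub₂`
(forget the certificate of the RC tree, then apply the crux). -/

/-- A strong-game tree read as a row-certified tree: run it on the matrices recovered from the
pulled-back vectors and certify the row of its own answer. -/
def certifyOwnRow {m n : ℕ} (P : KWTree (Fin m × Fin n)) : KWTree (RCIdx m n) :=
  P.comap (fun Z : RCIdx m n → Bool => fun e => Z (e, e.1))
    (fun Z : RCIdx m n → Bool => fun e => Z (e, e.1)) (fun e => (e, e.1))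

theorem run_certifyOwnRow {m n : ℕ} (P : KWTree (Fin m × Fin n)) (X Y : Fin m × Fin n → Bool) :
    (certifyOwnRow P).run (pullback X) (pullback Y) = (P.run X Y, (P.run X Y).1) := by
  simp [certifyOwnRow, pullback]

theorem depth_certifyOwnRow {m n : ℕ} (P : KWTree (Fin m × Fin n)) :
    (certifyOwnRow P).depth = P.depth := by
  simp [certifyOwnRow]

theorem solvesRC_certifyOwnRow {m n : ℕ} {P : KWTree (Fin m × Fin n)} {f : (Fin m → Bool) → Bool}
    {g : (Fin n → Bool) → Bool} (h : P.SolvesStrong f g) : SolvesRC (certifyOwnRow P) f g := by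
  intro X Y hX hY
  rw [run_certifyOwnRow]
  exact h X Y hX hY

/-- A row-certified tree read as a standard-composition tree: forget the certificate. -/
def forgetRow {m n : ℕ} (R : KWTree (RCIdx m n)) : KWTree (Fin m × Fin n) :=
  R.comap (fun X : Fin m × Fin n → Bool => pullback X) (fun Y : Fin m × Fin n → Bool => pullback Y)
    Prod.fst

theorem run_forgetRow {m n : ℕ} (R : KWTree (RCIdx m n)) (X Y : Fin m × Fin n → Bool) :
    (forgetRow R).run X Y = (R.run (pullback X) (pullback Y)).1 := by
  simp [forgetRow]

theorem depth_forgetRow {m n : ℕ} (R : KWTree (RCIdx m n)) : (forgetRow R).depth = R.depth := by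
  simp [forgetRow]

theorem solves_forgetRow {m n : ℕ} {R : KWTree (RCIdx m n)} {f : (Fin m → Bool) → Bool}
    {g : (Fin n → Bool) → Bool} (h : SolvesRC R f g) : (forgetRow R).Solves (blockComp f g) := by
  intro X Y hX hY
  rw [run_forgetRow]
  exact (h X Y hX hY).1

/-- `crux → stub₁`: the strong tree the crux provides certifies its own row. -/
theorem rowCertification_of_crux
    (h : Summit.PneNP.PneNP.Theses.KrwChromaticSteering.StandardFromStrong) :
    ∃ c : ℕ, ∀ m n : ℕ, 1 ≤ n → ∀ f : (Fin m → Bool) → Bool, (∃ a b, f a ≠ f b) →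
      ∃ g₀ : (Fin n → Bool) → Bool, ∀ g : (Fin n → Bool) → Bool,
        ∀ P : KWTree (Fin m × Fin n), P.Solves (blockComp f g₀) →
          ∃ R : KWTree (RCIdx m n), SolvesRC R f g ∧
            R.depth ≤ P.depth + c * (Nat.log 2 (m * n) + 1) := by
  obtain ⟨c, h⟩ := h
  refine ⟨c, fun m n hn f hf => ?_⟩
  obtain ⟨g₀, hg₀⟩ := h m n hn f hf
  refine ⟨g₀, fun g P hP => ?_⟩
  obtain ⟨P', hP', hd⟩ := hg₀ g P hP
  exact ⟨certifyOwnRow P', solvesRC_certifyOwnRow hP', by rw [depth_certifyOwnRow]; exact hd⟩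

/-- `crux → stub₂`: forget the certificate of the `RC_{f,g₀}` tree and apply the crux at `g₀`. -/
theorem entrySteering_of_crux
    (h : Summit.PneNP.PneNP.Theses.KrwChromaticSteering.StandardFromStrong) :
    ∃ c : ℕ, ∀ m n : ℕ, 1 ≤ n → ∀ f : (Fin m → Bool) → Bool, (∃ a b, f a ≠ f b) →
      ∃ g₁ : (Fin n → Bool) → Bool, ∀ g : (Fin n → Bool) → Bool,
        ∀ R : KWTree (RCIdx m n), SolvesRC R f g₁ →
          ∃ P' : KWTree (Fin m × Fin n), P'.SolvesStrong f g ∧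
            P'.depth ≤ R.depth + c * (Nat.log 2 (m * n) + 1) := by
  obtain ⟨c, h⟩ := h
  refine ⟨c, fun m n hn f hf => ?_⟩
  obtain ⟨g₀, hg₀⟩ := h m n hn f hf
  refine ⟨g₀, fun g R hR => ?_⟩
  obtain ⟨P', hP', hd⟩ := hg₀ g (forgetRow R) (solves_forgetRow hR)
  exact ⟨P', hP', by rw [depth_forgetRow] at hd; exact hd⟩

end Summit.PneNP.PneNP.Cruxes.StandardFromStrong.Birth
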